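import Mathlib
import Summits.ValiantsHypothesis.ValiantsHypothesis.Theorems.AlgebraicKWGamesBoundedAlternationLowerBoundPotential

/-!
# Bounded-alternation algebraic KW protocols: the lexicographic count

Support lemmas for item `stmt-ValiantsHypothesis-10299` (`…Theses.AlgebraicKWGames.BoundedAlternationLowerBound`).
The digit of block index `v` on the identified set `E` is
`dg E v = (rk (Xall ∪ Pref E v) − n²) + (rk (BE E ∪ Pref E v) − n²) ∈ [0, 2T]`, and the potential is
the base-`(2T+1)` number with digits `dg E 0, …, dg E Δ` (most significant first, Horner form).
By `AltProtocol.round` one adversary round strictly decreases the potential (`pot_lt`), so after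
`(2T+1)^(Δ+1)` rounds — available as soon as that many plus one cells fit into the matrix — we reach
a contradiction: `AltProtocol.false_of_le`, no correct protocol with a monotone `≤ Δ`-alternation
schedule exists.

Honest framing: a toy-model lower bound (bounded alternation); nothing here bears on VP versus VNP.
-/

open MvPolynomial

-- the summit and the problem share the name `ValiantsHypothesis` (D-0017 single-conjunct layout)
set_option linter.dupNamespace false

namespace Summit.ValiantsHypothesis.ValiantsHypothesis.Theorems.AlgebraicKWGames.OneAlt

open scoped Classical

noncomputable section

variable {n : ℕ}

/-! ## `ℕ∞` bookkeeping -/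

/-- Monotonicity of `toNat` below a finite bound. -/
theorem toNat_le_toNat_of_le {a b : ℕ∞} {K : ℕ} (hb : b ≤ K) (h : a ≤ b) : a.toNat ≤ b.toNat := by
  have hb' : b ≠ ⊤ := ne_top_of_le_ne_top (ENat.coe_ne_top K) hb
  have ha' : a ≠ ⊤ := ne_top_of_le_ne_top hb' h
  lift b to ℕ using hb'
  lift a to ℕ using ha'
  simp only [ENat.toNat_coe]
  exact_mod_cast h

/-- Strict monotonicity of `toNat` below a finite bound. -/
theorem toNat_lt_toNat_of_lt {a b : ℕ∞} {K : ℕ} (hb : b ≤ K) (h : a < b) : a.toNat < b.toNat := by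
  have hb' : b ≠ ⊤ := ne_top_of_le_ne_top (ENat.coe_ne_top K) hb
  have ha' : a ≠ ⊤ := ne_top_of_le_ne_top hb' h.le
  lift b to ℕ using hb'
  lift a to ℕ using ha'
  simp only [ENat.toNat_coe]
  exact_mod_cast h

/-- A natural-number lower bound passes to `toNat` below a finite bound. -/
theorem le_toNat_of_coe_le {a : ℕ∞} {K m : ℕ} (ha : a ≤ K) (h : (m : ℕ∞) ≤ a) : m ≤ a.toNat := by
  have ha' : a ≠ ⊤ := ne_top_of_le_ne_top (ENat.coe_ne_top K) ha
  lift a to ℕ using ha'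
  simp only [ENat.toNat_coe]
  exact_mod_cast h

/-- A natural-number upper bound passes to `toNat`. -/
theorem toNat_le_of_le_coe {a : ℕ∞} {m : ℕ} (h : a ≤ m) : a.toNat ≤ m := by
  have ha' : a ≠ ⊤ := ne_top_of_le_ne_top (ENat.coe_ne_top m) h
  lift a to ℕ using ha'
  simp only [ENat.toNat_coe]
  exact_mod_cast h

/-! ## Horner numbers -/

/-- The number with digits `d 0, …, d k` (most significant first) in base `b`. -/
def horner (b : ℕ) (d : ℕ → ℕ) : ℕ → ℕ
  | 0 => d 0
  | k + 1 => horner b d k * b + d (k + 1)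

/-- A Horner number with digits `< b` is `< b^(k+1)`. -/
theorem horner_lt (b : ℕ) (d : ℕ → ℕ) (hd : ∀ v, d v < b) : ∀ k, horner b d k + 1 ≤ b ^ (k + 1) := by
  intro k
  induction k with
  | zero => simpa [horner] using hd 0
  | succ k ih =>
    have h1 := hd (k + 1)
    calc horner b d (k + 1) + 1 = horner b d k * b + (d (k + 1) + 1) := by simp [horner, add_assoc]
      _ ≤ horner b d k * b + b := by omega
      _ = (horner b d k + 1) * b := by ring
      _ ≤ b ^ (k + 1) * b := Nat.mul_le_mul_right b ih
      _ = b ^ (k + 1 + 1) := by ring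

/-- Digitwise comparison of Horner numbers. -/
theorem horner_le_horner (b : ℕ) {f g : ℕ → ℕ} : ∀ k, (∀ v ≤ k, g v ≤ f v) →
    horner b g k ≤ horner b f k := by
  intro k
  induction k with
  | zero => intro h; simpa [horner] using h 0 le_rfl
  | succ k ih =>
    intro h
    have h1 := ih (fun v hv => h v (Nat.le_succ_of_le hv))
    have h2 := h (k + 1) le_rfl
    simp only [horner]
    nlinarith

/-- **Lexicographic comparison.**  If the digits of `g` are `< b`, agree-or-decrease before position
`v₀` and strictly decrease at `v₀ ≤ k`, then the Horner number of `g` is smaller. -/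
theorem horner_lt_horner (b : ℕ) {f g : ℕ → ℕ} (hg : ∀ v, g v < b) :
    ∀ k v₀, v₀ ≤ k → g v₀ < f v₀ → (∀ v < v₀, g v ≤ f v) → horner b g k < horner b f k := by
  intro k
  induction k with
  | zero =>
    intro v₀ hv₀ hlt _
    have : v₀ = 0 := by omega
    subst this
    simpa [horner] using hlt
  | succ k ih =>
    intro v₀ hv₀ hlt hle
    rcases Nat.lt_or_ge v₀ (k + 1) with hv | hv
    · have h1 : horner b g k + 1 ≤ horner b f k := ih v₀ (by omega) hlt hle
      have h2 := hg (k + 1)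
      calc horner b g (k + 1) = horner b g k * b + g (k + 1) := rfl
        _ < horner b g k * b + b := by omega
        _ = (horner b g k + 1) * b := by ring
        _ ≤ horner b f k * b := Nat.mul_le_mul_right b h1
        _ ≤ horner b f k * b + f (k + 1) := Nat.le_add_right _ _
        _ = horner b f (k + 1) := rfl
    · have hv' : v₀ = k + 1 := by omega
      subst hv'
      have h1 : horner b g k ≤ horner b f k := horner_le_horner b k (fun v hv => hle v (by omega))
      calc horner b g (k + 1) = horner b g k * b + g (k + 1) := rfl
        _ < horner b f k * b + f (k + 1) := by nlinarith
        _ = horner b f (k + 1) := rfl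

/-! ## The digits of the adversary -/

variable {T : ℕ} (P : AltProtocol n T)

namespace AltProtocol

/-- The digit of block index `v` on `E`: the two rank measures minus their common minimum `2n²`. -/
def dg (E : Finset (Cell n)) (v : ℕ) : ℕ :=
  ((Mat n).eRk (Xall ∪ P.Pref E v)).toNat + ((Mat n).eRk (BE E ∪ P.Pref E v)).toNat -
    2 * Fintype.card (Cell n)

/-- Bounds for a rank measure: between `n²` and `n² + T`. -/
theorem eRk_base_union_Pref_bounds (E : Finset (Cell n)) (v w : ℕ) :
    (Fintype.card (Cell n) : ℕ∞) ≤ (Mat n).eRk (base E w ∪ P.Pref E v) ∧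
      (Mat n).eRk (base E w ∪ P.Pref E v) ≤ ((Fintype.card (Cell n) + T : ℕ) : ℕ∞) := by
  constructor
  · rw [← encard_base E w, ← (indep_base E w).eRk_eq_encard]
    exact (Mat n).eRk_mono Set.subset_union_left
  · refine ((Mat n).eRk_le_encard _).trans ?_
    refine (Set.encard_union_le _ _).trans ?_
    rw [encard_base, Nat.cast_add]
    exact add_le_add le_rfl (P.encard_Pref_le E v)

/-- Bounds for Alice's measure. -/
theorem eRk_Xall_union_Pref_bounds (E : Finset (Cell n)) (v : ℕ) :
    (Fintype.card (Cell n) : ℕ∞) ≤ (Mat n).eRk (Xall ∪ P.Pref E v) ∧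
      (Mat n).eRk (Xall ∪ P.Pref E v) ≤ ((Fintype.card (Cell n) + T : ℕ) : ℕ∞) := by
  simpa [base] using P.eRk_base_union_Pref_bounds E v 0

/-- Bounds for Bob's measure. -/
theorem eRk_BE_union_Pref_bounds (E : Finset (Cell n)) (v : ℕ) :
    (Fintype.card (Cell n) : ℕ∞) ≤ (Mat n).eRk (BE E ∪ P.Pref E v) ∧
      (Mat n).eRk (BE E ∪ P.Pref E v) ≤ ((Fintype.card (Cell n) + T : ℕ) : ℕ∞) := by
  simpa [base] using P.eRk_base_union_Pref_bounds E v 1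

/-- Digits are at most `2T`. -/
theorem dg_le (E : Finset (Cell n)) (v : ℕ) : P.dg E v ≤ 2 * T := by
  have hA := toNat_le_of_le_coe (P.eRk_Xall_union_Pref_bounds E v).2
  have hB := toNat_le_of_le_coe (P.eRk_BE_union_Pref_bounds E v).2
  unfold dg
  omega

/-- **The potential decreases.**  One adversary round (two cells to spare) produces a new cell and
decreases the base-`(2T+1)` potential with digits `dg E 0, …, dg E Δ`, provided the schedule has at
most `Δ` alternations. -/
theorem pot_lt {Δ : ℕ} (hΔ : ∀ t, P.blk t ≤ Δ) (E : Finset (Cell n)) {e₀ : Cell n} (he₀ : e₀ ∉ E)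
    (hroom : ∀ e, ∃ e₁, e₁ ∉ insert e E) :
    P.genOut E ∉ E ∧
      horner (2 * T + 1) (P.dg (insert (P.genOut E) E)) Δ < horner (2 * T + 1) (P.dg E) Δ := by
  obtain ⟨hnot, t₀, ht₀, hweak, hstrict⟩ := P.round E he₀ hroom
  refine ⟨hnot, ?_⟩
  set F := insert (P.genOut E) E with hF
  set N2 := Fintype.card (Cell n) with hN2
  apply horner_lt_horner (2 * T + 1) (fun v => Nat.lt_succ_of_le (P.dg_le F v)) Δ (P.blk t₀) (hΔ t₀)
  · -- strict drop at `v₀ = blk t₀`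
    obtain ⟨hwA, hwB⟩ := hweak (P.blk t₀) le_rfl
    have hAF := P.eRk_Xall_union_Pref_bounds F (P.blk t₀)
    have hBF := P.eRk_BE_union_Pref_bounds F (P.blk t₀)
    have hAE := P.eRk_Xall_union_Pref_bounds E (P.blk t₀)
    have hBE := P.eRk_BE_union_Pref_bounds E (P.blk t₀)
    have h1 := toNat_le_toNat_of_le hAE.2 hwA
    have h2 := toNat_le_toNat_of_le hBE.2 hwB
    have h3 := le_toNat_of_coe_le hAF.2 hAF.1
    have h4 := le_toNat_of_coe_le hBF.2 hBF.1
    by_cases hv : Even (P.blk t₀)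
    · simp only [base, if_pos hv] at hstrict
      have h5 := toNat_lt_toNat_of_lt hAE.2 hstrict
      unfold dg; omega
    · simp only [base, if_neg hv] at hstrict
      have h5 := toNat_lt_toNat_of_lt hBE.2 hstrict
      unfold dg; omega
  · -- weak drop before
    intro v hv
    obtain ⟨hwA, hwB⟩ := hweak v hv.le
    have h1 := toNat_le_toNat_of_le (P.eRk_Xall_union_Pref_bounds E v).2 hwA
    have h2 := toNat_le_toNat_of_le (P.eRk_BE_union_Pref_bounds E v).2 hwB
    unfold dg; omega

/-! ## Iterating the adversary -/

/-- The adversary's sequence of identified sets. -/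
def Eseq : ℕ → Finset (Cell n)
  | 0 => ∅
  | i + 1 => insert (P.genOut (Eseq i)) (Eseq i)

/-- Two cells to spare give the room hypotheses of an adversary round. -/
theorem room_of_card_le (E : Finset (Cell n)) (h : E.card + 2 ≤ Fintype.card (Cell n)) :
    (∃ e₀, e₀ ∉ E) ∧ ∀ e, ∃ e₁, e₁ ∉ insert e E := by
  constructor
  · by_contra hall
    push Not at hall
    have hsub : Finset.univ ⊆ E := fun c _ => hall c
    have := Finset.card_le_card hsub
    rw [Finset.card_univ] at this
    omega
  · intro e
    by_contra hall
    push Not at hall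
    have hsub : Finset.univ ⊆ insert e E := fun c _ => hall c
    have := (Finset.card_le_card hsub).trans (Finset.card_insert_le e E)
    rw [Finset.card_univ] at this
    omega

/-- Along the adversary's sequence the potential drops by one per round while cells are to spare. -/
theorem Eseq_pot {Δ : ℕ} (hΔ : ∀ t, P.blk t ≤ Δ) (K : ℕ) (hK : K + 1 ≤ Fintype.card (Cell n)) :
    ∀ i ≤ K, (P.Eseq i).card = i ∧
      horner (2 * T + 1) (P.dg (P.Eseq i)) Δ + i ≤ horner (2 * T + 1) (P.dg ∅) Δ := by
  intro i
  induction i with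
  | zero => intro _; exact ⟨rfl, by simp [Eseq]⟩
  | succ i ih =>
    intro hi
    obtain ⟨hcard, hpot⟩ := ih (by omega)
    obtain ⟨⟨e₀, he₀⟩, hroom⟩ := room_of_card_le (P.Eseq i) (by omega)
    obtain ⟨hnot, hlt⟩ := P.pot_lt hΔ (P.Eseq i) he₀ hroom
    refine ⟨?_, ?_⟩
    · show (insert (P.genOut (P.Eseq i)) (P.Eseq i)).card = i + 1
      rw [Finset.card_insert_of_notMem hnot, hcard]
    · show horner (2 * T + 1) (P.dg (insert (P.genOut (P.Eseq i)) (P.Eseq i))) Δ + (i + 1) ≤ _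
      omega

/-- **No correct protocol with a monotone schedule of at most `Δ` alternations** once
`(2T+1)^(Δ+1) + 1` cells fit into the matrix. -/
theorem false_of_le {Δ : ℕ} (hΔ : ∀ t, P.blk t ≤ Δ)
    (hroom : (2 * T + 1) ^ (Δ + 1) + 1 ≤ Fintype.card (Cell n)) : False := by
  obtain ⟨-, hpot⟩ := P.Eseq_pot hΔ ((2 * T + 1) ^ (Δ + 1)) hroom _ le_rfl
  have hbound := horner_lt (2 * T + 1) (P.dg ∅) (fun v => Nat.lt_succ_of_le (P.dg_le ∅ v)) Δ
  omega

end AltProtocol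

end

end Summit.ValiantsHypothesis.ValiantsHypothesis.Theorems.AlgebraicKWGames.OneAlt
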